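import Literature.Geometry.Lorentzian.KerrCarterConstant
import Literature.Geometry.Lorentzian.KerrRegionIINullRayCore
import Literature.Geometry.Lorentzian.KerrExactRegionFacts
import Literature.Geometry.Lorentzian.FutureNullCompleteness
import Literature.Geometry.Lorentzian.KerrNullFrameFlux
import Literature.Geometry.Lorentzian.KerrSchildChartCovariance
import HarnessLib

/-!
# No future-complete null geodesic of the Kerr chart `{r > r₋}` meets the black-hole interior

(family `gr`; namespace `Literature.Geometry.Lorentzian.Kerr`; all results proved; discharge of
the named fact `KerrBlackHoleNoCompleteNullRay` of `KerrExactRegionFacts.lean`.)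

**Theorem** (`Kerr.rPlus_le_radius_of_isGeodesicOn_Ioi`, `KerrBlackHoleNoCompleteNullRay_holds`;
O'Neill 1995, Ch. 4, §4.2–§4.3 with Ch. 2, §2.5; Hawking–Ellis 1973, §5.6). In the ingoing
Kerr–Schild chart `Kerr.spacetime M a r₋ hM = ({r > r₋}, g_{M,a}, −g♯dt*)` of a sub-extremal Kerr
black hole (`|a| < M`), a geodesic defined on a whole parameter ray `(t₀, ∞)` whose velocity at some
`t₁ > t₀` is null and future-directed has `r(γ t₁) ≥ r₊`: every future-directed null geodesic of
Boyer–Lindquist block II `{r₋ < r < r₊}` leaves every compact subset of `{r > r₋}` — it reaches the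
Cauchy horizon `{r = r₋}` — at FINITE affine parameter.

## Proof

Suppose `r(γ t₁) < r₊`. The velocity stays null and future-directed along the ray
(`IsGeodesicOn.isNull_and_isFutureDirected_velocity`), so `γ|[t₁, ∞)` is a future causal curve of
block II: `r ∘ γ` stays in `(r₋, r₊)` and is non-increasing (`Kerr.radius_causalCurve_le`,
`KerrRegionIIDiameter.lean`), with `ṙ = dr(γ') < 0` (`Kerr.radiusGrad_lt_zero_of_isFutureDirected`).
Along the ray the Killing energies `E`, `L` and Carter's constant `𝒦 ≥ 0` are conserved
(`KerrCarterConstant.lean`, `KerrCarterPointwise.lean`), whence Carter's radial equation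
`Σ² ṙ² = R(r) := ℙ(r)² − Δ(r) 𝒦`, `ℙ(r) = E(r² + a²) − aL`, and the polar bound
`(L − a sin²θ E)² ≤ sin²θ 𝒦` (O'Neill 1995, Thm. 4.2.2). Let `r⋆ = inf (r ∘ γ) ∈ [r₋, r₊)`. Two
elementary escape lemmas (`not_forall_gt_of_deriv_le_neg`: `ṙ ≤ −c < 0`;
`not_forall_gt_of_sq_deriv_ge`: `ṙ ≤ 0`, `ṙ² ≥ c (r − r₋)`) show that a uniform drift would make `r`
leave `{r > r₋}` in finite parameter time. Hence `R(r⋆) = 0` (else `R ≥ R(r⋆)/2 > 0` near `r⋆`), i.e.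
`ℙ(r⋆) = 0` and `Δ(r⋆) 𝒦 = 0`.
* `r⋆ > r₋`: `Δ(r⋆) < 0` gives `𝒦 = 0`, the polar bound gives `L = a sin²θ E` along the ray, so
  `|ℙ(r)| = |E|(r² + a² cos²θ) ≥ |E| r⋆²` while `ℙ(r) = E(r² − r⋆²) → 0`: `E = 0 = L`, a trivial ray
  (`ṙ(t₁) = 0`) — contradiction.
* `r⋆ = r₋`, `𝒦 > 0`: `Σ² ṙ² ≥ (r₊ − r(t₁)) 𝒦 (r − r₋)` — the square-root escape.
* `r⋆ = r₋`, `𝒦 = 0`: `L = a sin²θ E` and `(r₋² + a²) E = aL`; for `a ≠ 0` this forces `E = 0 = L`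
  (`a² sin²θ ≤ a² < r₋² + a²`), for `a = 0` it gives `ṙ = −|E|` constant — contradiction either way.

This is the content of O'Neill 1995, §4.3 ("block II is one-way"; the `r`-motion of its null
geodesics), organised so that only the conservation laws and the signs `𝒦 ≥ 0`, `Σ²θ̇² ≥ 0` enter.

## References

* B. O'Neill, *The geometry of Kerr black holes*, A K Peters 1995, Ch. 2, §2.5; Ch. 4, §4.2–§4.3.
  Key `ONeill1995`.
* S. W. Hawking, G. F. R. Ellis, *The large scale structure of space-time*, CUP 1973, §5.6.
  Key `HawkingEllis1973CUP`.
* B. Carter, Phys. Rev. 174 (1968) 1559–1571, §IV. Key `Carter1968`.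
-/

noncomputable section

set_option maxSynthPendingDepth 3

open Set Function Module Real Bundle Filter
open scoped Topology ContDiff Manifold
open Literature.Geometry.Lorentzian.MetricCoord

namespace Literature.Geometry.Lorentzian

namespace Kerr

/-! ### Carter dynamics of a future null geodesic ray in region II -/

section RegionII

variable {M a : ℝ}

variable [Facts]


/-- **No future null geodesic ray of the Kerr chart `{r > r₋}` starts inside the black hole**
(sub-extremal Kerr, `|a| < M`; O'Neill 1995, Ch. 4, §4.3 with Ch. 2, §2.5: block II is one-way and
its null geodesics reach the Cauchy horizon `{r = r₋}` at finite affine parameter). Let `γ` be a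
geodesic of `g_{M,a}` on `Kerr.region a r₋` defined on the parameter ray `(t₀, ∞)`, with null
future-directed velocity at some `t₁ > t₀`. Then `r(γ t₁) ≥ r₊`.

Proof. Suppose `r(γ t₁) < r₊`. The velocity stays null and future-directed
(`IsGeodesicOn.isNull_and_isFutureDirected_velocity`), so `γ|[t₁, ∞)` is a future causal curve of
region II: `r ∘ γ < r₊` stays in `(r₋, r₊)`, is non-increasing (`Kerr.radius_causalCurve_le`) with
`ṙ = dr(γ') < 0` (`Kerr.radiusGrad_lt_zero_of_isFutureDirected`). Along it the Killing energies
`E, L` and Carter's constant `𝒦 ≥ 0` are conserved (`KerrCarterConstant.lean`,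
`KerrCarterPointwise.lean`), whence the radial equation `Σ² ṙ² = ℙ(r)² − Δ(r) 𝒦`,
`ℙ(r) = E(r² + a²) − aL`, and the polar bound `(L − a sin²θ E)² ≤ sin²θ 𝒦`. Let `r⋆ = inf r ∘ γ ∈ [r₋, r₊)`.
If `ℙ(r⋆)² − Δ(r⋆)𝒦 > 0` then eventually `ṙ ≤ −c < 0` and `r` would leave `{r > r₋}` — so
`ℙ(r⋆) = 0` and `Δ(r⋆)𝒦 = 0`. If `r⋆ > r₋`: `𝒦 = 0`, so `L = a sin²θ E` along the ray and
`|ℙ(r)| ≥ |E| r²`; with `ℙ(r⋆) = 0` this forces `E = 0 = L`, `ṙ ≡ 0` — contradiction. If `r⋆ = r₋`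
and `𝒦 > 0`: `Σ² ṙ² ≥ (r₊ − r(t₁)) 𝒦 (r − r₋)` and `√(r − r₋)` decreases at a uniform rate —
contradiction. If `r⋆ = r₋` and `𝒦 = 0`: `L = a sin²θ E` and `(r₋² + a²)E = aL` force `E = 0 = L`
(`a ≠ 0`: `a² sin²θ < r₋² + a²`; `a = 0`: `ṙ = −|E|` is constant) — contradiction again.
[cite: ONeill1995, Ch. 4, §4.2–§4.3] -/
theorem rPlus_le_radius_of_isGeodesicOn_Ioi (h : |a| < M) (hM : 0 ≤ M)
    [(spacetime M a (rMinus M a) hM).metric.HasLeviCivita]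
    {γ : ℝ → region a (rMinus M a)} {t₀ t₁ : ℝ} (ht₀₁ : t₀ < t₁)
    (hγ : IsGeodesicOn (spacetime M a (rMinus M a) hM).metric.leviCivita γ (Ioi t₀))
    (hN : (spacetime M a (rMinus M a) hM).metric.IsNull (velocity 𝓘(ℝ, E4) γ t₁))
    (hF : (spacetime M a (rMinus M a) hM).timeOrientation.IsFutureDirected (velocity 𝓘(ℝ, E4) γ t₁)) :
    rPlus M a ≤ radius a (γ t₁) := by
  by_contra hlt
  push Not at hlt
  set 𝓚 := spacetime M a (rMinus M a) hM with h𝓚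
  haveI : (smoothMetric M a (rMinus M a)).HasLeviCivita :=
    inferInstanceAs ((spacetime M a (rMinus M a) hM).metric.HasLeviCivita)
  have ha2 : a ^ 2 ≤ M ^ 2 := sq_le_sq_of_isSubextremal h
  have hrmp : rMinus M a < rPlus M a := IsSubextremal.rMinus_lt_rPlus h
  -- instances for the propagation lemma
  haveI : Fact ((1 : ℕ∞ω) ≤ ((⊤ : ℕ∞) : WithTop ℕ∞)) := ⟨by exact_mod_cast le_top⟩
  haveI : CovariantDerivative.ContMDiffCovariantDerivative 𝓚.metric.leviCivita 1 :=
    ⟨𝓚.metric.toPseudoRiemannianMetric.isLocallyContMDiff_leviCivita_holds 1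
      (by rw [show ((1 : ℕ∞) : ℕ∞ω) + 1 = 2 by norm_num]; exact WithTop.coe_le_coe.2 le_top)
      univ isOpen_univ⟩
  -- (a) null and future-directed along the whole ray
  have hNF : ∀ t ∈ Ioi t₀, 𝓚.metric.IsNull (velocity 𝓘(ℝ, E4) γ t) ∧
      𝓚.timeOrientation.IsFutureDirected (velocity 𝓘(ℝ, E4) γ t) := fun t ht ↦
    hγ.isNull_and_isFutureDirected_velocity 𝓚.metric 𝓚.timeOrientation isOpen_Ioi
      Set.ordConnected_Ioi ht₀₁ hN hF ht
  have hcurve : ∀ s ⊆ Ioi t₀, 𝓚.metric.IsFutureCausalCurveOn 𝓚.timeOrientation γ s :=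
    fun s hs t ht ↦ ⟨IsGeodesicOn.mdifferentiableAt_holds hγ (hs ht), (hNF t (hs ht)).2⟩
  -- notation along the ray
  set rf : ℝ → ℝ := fun t ↦ radius a (γ t) with hrf
  set w : ℝ → E4 := fun t ↦ velocity 𝓘(ℝ, E4) γ t with hw
  set ρ : ℝ → ℝ := fun t ↦ fderiv ℝ (radius a) (γ t) (w t) with hρ
  set Sg : ℝ → ℝ := fun t ↦ blSigma a (E4.spatial (γ t : E4)) with hSg
  have hx : ∀ t, 0 < radius a (γ t) := fun t ↦ radius_pos_of_mem_region (γ t).2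
  have hrm : ∀ t, rMinus M a < rf t := fun t ↦ lt_radius_of_mem_region (γ t).2
  -- the geodesic, read for the Carter file
  have hγ' : IsGeodesicOn (smoothMetric M a (rMinus M a)).toPseudoRiemannianMetric.leviCivita γ (Ioi t₀) :=
    hγ
  -- (b) `r < r₊` and non-increasing on `[t₁, ∞)`
  have hrp : ∀ t, t₁ ≤ t → rf t < rPlus M a := fun t ht ↦
    (radius_causalCurve_le (hM := hM) h (hcurve (Icc t₁ t) fun σ hσ ↦ ht₀₁.trans_le hσ.1) hlt
      (right_mem_Icc.2 ht)).trans_lt hlt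
  have hmono : ∀ t t', t₁ ≤ t → t ≤ t' → rf t' ≤ rf t := fun t t' ht htt' ↦
    radius_causalCurve_le (hM := hM) h (hcurve (Icc t t') fun σ hσ ↦ (ht₀₁.trans_le ht).trans_le hσ.1)
      (hrp t ht) (right_mem_Icc.2 htt')
  -- (c) `ṙ = ρ < 0`
  have hder : ∀ t, t₁ ≤ t → HasDerivAt rf (ρ t) t := fun t ht ↦
    hasDerivAt_radius_comp hγ' (ht₀₁.trans_le ht)
  have hρeq : ∀ t, t₁ ≤ t → ρ t = radiusGrad a (E4.spatial (γ t : E4)) (E4.spatial (w t)) := by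
    intro t ht
    show fderiv ℝ (radius a) (γ t) (w t) = _
    rw [(hasFDerivAt_radius (hx t)).fderiv]
    rfl
  have hρneg : ∀ t, t₁ ≤ t → ρ t < 0 := by
    intro t ht
    obtain ⟨⟨hnull, hne⟩, -, hfd⟩ := hNF t (ht₀₁.trans_le ht)
    rw [hρeq t ht]
    exact radiusGrad_lt_zero_of_isFutureDirected h (hrm t) (hrp t ht) (le_of_eq hnull) hne hfd
  -- (d) null, `Δ < 0`, and the conserved quantities
  have hnull : ∀ t ∈ Ioi t₀, Kerr.bilin M a (γ t) (w t) (w t) = 0 := fun t ht ↦ (hNF t ht).1.1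
  have hΔ : ∀ t, t₁ ≤ t → rf t ^ 2 - 2 * M * rf t + a ^ 2 < 0 := fun t ht ↦
    delta_neg_of_between h (hrm t) (hrp t ht)
  set E := ksEnergy M a (γ t₁) (w t₁) with hE
  set L := ksAngMom M a (γ t₁) (w t₁) with hL
  set K := ksCarterK M a (γ t₁) (w t₁) with hK
  have hEt : ∀ t, t₁ ≤ t → ksEnergy M a (γ t) (w t) = E := fun t ht ↦
    ksEnergy_eq_of_isGeodesicOn hγ' Set.ordConnected_Ioi (ht₀₁.trans_le ht) ht₀₁
  have hLt : ∀ t, t₁ ≤ t → ksAngMom M a (γ t) (w t) = L := fun t ht ↦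
    ksAngMom_eq_of_isGeodesicOn hγ' Set.ordConnected_Ioi (ht₀₁.trans_le ht) ht₀₁
  have hKt : ∀ t, t₁ ≤ t → ksCarterK M a (γ t) (w t) = K := by
    intro t ht
    refine ksCarterK_eq_of_isGeodesicOn (s := Ici t₁)
      (hγ'.mono fun σ hσ ↦ ht₀₁.trans_le hσ) Set.ordConnected_Ici
      (fun σ hσ ↦ hnull σ (ht₀₁.trans_le hσ)) (fun σ hσ ↦ (hΔ σ hσ).ne) ht self_mem_Ici
  have hK0 : 0 ≤ K :=
    ksCarterK_nonneg (hx t₁) (hΔ t₁ le_rfl).ne (hnull t₁ ht₀₁)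
  -- (e) the radial equation and the polar bound along the ray
  have hrad : ∀ t, t₁ ≤ t → Sg t ^ 2 * ρ t ^ 2 =
      (E * (rf t ^ 2 + a ^ 2) - a * L) ^ 2 - (rf t ^ 2 - 2 * M * rf t + a ^ 2) * K := by
    intro t ht
    have hk := hKt t ht
    unfold ksCarterK at hk
    rw [hEt t ht, hLt t ht] at hk
    have hΔne := (hΔ t ht).ne
    rw [div_eq_iff hΔne] at hk
    show blSigma a (E4.spatial (γ t : E4)) ^ 2 * fderiv ℝ (radius a) (γ t) (w t) ^ 2 = _
    linarith only [hk]
  have hpol : ∀ t, t₁ ≤ t →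
      (L - a * (1 - ((γ t : E4) 3 / rf t) ^ 2) * E) ^ 2 ≤ (1 - ((γ t : E4) 3 / rf t) ^ 2) * K := by
    intro t ht
    have hp := sq_sub_le_sinSq_mul_ksCarterK (M := M) (hx t) (hΔ t ht).ne (hnull t (ht₀₁.trans_le ht))
    rw [hEt t ht, hLt t ht, hKt t ht] at hp
    exact hp
  -- bounds: `r² ≤ Σ`, `Σ > 0`, `0 ≤ 1 − (z/r)² ≤ 1`
  have hSge : ∀ t, rf t ^ 2 ≤ Sg t := fun t ↦ sq_le_blSigma_spatial (hx t)
  have hSpos : ∀ t, 0 < Sg t := fun t ↦ blSigma_spatial_pos (hx t)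
  have hs01 : ∀ t, 0 ≤ 1 - ((γ t : E4) 3 / rf t) ^ 2 ∧ 1 - ((γ t : E4) 3 / rf t) ^ 2 ≤ 1 := by
    intro t
    have h3 := KerrSchildChart.abs_apply_three_le_radius (hx t)
    have hr0 := hx t
    constructor
    · rw [sub_nonneg, div_pow, div_le_one (by positivity)]
      exact sq_le_sq' (abs_le.1 h3).1 (abs_le.1 h3).2
    · linarith [sq_nonneg ((γ t : E4) 3 / rf t)]
  -- the real-variable core (`KerrRegionIINullRayCore.lean`)
  exact regionII_ray_contradiction (s2 := fun t ↦ 1 - ((γ t : E4) 3 / rf t) ^ 2) ha2 hrmp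
    (IsSubextremal.rMinus_nonneg h) (fun ha0 ↦ rMinus_pos_of_ne_zero h ha0) hder hρneg hrm hrp
    hmono hK0 hrad hpol (fun t ↦ blSigma_spatial_le a (γ t : E4)) hSge hSpos hs01

/-! ### Discharge of the named fact -/

omit [Facts] in
/-- **No future-complete null geodesic of the Kerr chart `{r > r₋}` meets the black-hole interior
`{r < r₊}`** — the named fact `KerrBlackHoleNoCompleteNullRay` of `KerrExactRegionFacts.lean`
HOLDS (`Kerr.rPlus_le_radius_of_isGeodesicOn_Ioi`). O'Neill 1995, Ch. 4, §4.2–§4.3;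
Hawking–Ellis 1973, §5.6. [cite: ONeill1995, Ch. 4, §4.2–§4.3] -/
theorem _root_.Literature.Geometry.Lorentzian.KerrBlackHoleNoCompleteNullRay_holds :
    KerrBlackHoleNoCompleteNullRay := by
  intro _ M a hM h _ γ t₀ t₁ ht hγ hN hF
  exact Kerr.rPlus_le_radius_of_isGeodesicOn_Ioi h hM ht hγ hN hF

end RegionII

end Kerr

end Literature.Geometry.Lorentzian

end
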